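import Summits.QuantumFields.BalabanUV.Beta.GAN24.ContactOneGaugeCellLambda
import Summits.QuantumFields.BalabanUV.Beta.GAN24.Push3GaugeSlotCells
import Summits.QuantumFields.BalabanUV.Beta.GAN24.Push3LegTelescope
import Summits.QuantumFields.BalabanUV.Beta.GAN24.SymHessianGaugeLegContact

/-!
# `BalabanUV.Beta.GAN24.SymPush3LambdaGaugeSlotCells` — binder row G-an2-4 ∕ (CONV-C), TRANSFER-III, the (III′) S-slot (b) of the END, born-Λ contact letter `hCg` (road-P2 M.104's
# 3rd hypothesis), TABLE HALF («mksym lane»), PART 5: **A PURE-GAUGE LEG IN THE LEFT SLOT OF THE PUSH `push₃ l r w SΛ` OF THE Λ-PIECE `SΛ = SLam L c (symHessFFAt ρ L)` OF an1's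
# (0.4)-SYMMETRISED CONSTRAINT HESSIAN** — locality ∕ window ∕ size of `SΛ`, and the LEFT slot = the Λ one-gauge cell sum with the kernel `q¹_sym = symLinKerAt ρ`: the decl-by-decl
# twin of leaf-02 g47's `Push3LambdaGaugeSlotCells` with `hessFFAt ↦ symHessFFAt` (leaf-02 g47's `SymHessianGaugeLegContact` — `SLam_symHessFFAt_*`, `tsum_coeff_mul_symHessKerAt_eq_sum`,
# `tsum_dz_mul_SLam_symHessFFAt` — and an1's `symHessKerAt_eq_zero_left ∕ _right`, `abs_symHessKerAt_le`, `biLoc_symHessFFAt` BY NAME; same constants)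
# (G-an2-4 CRUX TEAM (2), leaf prover `b2b-balaban-gan24-formalise-leaf-01`, gen 90)

WHAT IS PROVED (generic `d`, box root; [folklore]): §1 `locStencil_SLam_symHessFFAt`, `SLam_symHessFFAt_eq_zero_of_not_window`, `abs_SLam_symHessFFAt_le_sum`, `summable_mul_SLam_symHessFFAt_idx`,
`vertexW_lambda_antisymm`, `vertexW_lambda_eq_zero_of_not_window`, `exists_vertexW_lambda_bound`; §2 `inner_gaugeLeft_lambda`, **`push₃_gaugeLeft_lambda`**
(`push₃ (dz λ) r w SΛ κ′u′ x′z′ (inl α)(inl β) = Σ'_z Σ_b r β z′ b z·Σ'_u Σ_κ w κ′ u′ κ u·KΛ_sym(λ_{αx′}; κ,u; b,z)`, `KΛ_sym` with `symLinKerAt`).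
NOT HERE: the other two slots and the contact term (PART 6 `SymPush3LambdaKernelCells`).

NOT IN PRINT; OUR BOOKKEEPING ([folklore]; 0 `def`, 0 cited fact, 0 `def … : Prop`, 0 sorry).  HONEST FRAMING (cell contract, verbatim): «discharging `BetaPertH` makes
Bałaban's UV stability UNCONDITIONAL — a real constructive-QFT result; it is NOT the continuum limit and NOT the Clay problem.»  HONEST DEPENDENCY (verbatim): «continuum YM
on T⁴ ⇐ BetaPertH ∧ nine spine estimates (0/9 proved); BetaPertH ⇐ (D1) ∧ (D4) ∧ CAP+tail; G-an2-4 gates asym, D1 and NE2/3/4.»  Discharges NO letter of M.104 by itself;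
NEVER «G-an2-4 closed» as (CONV-C); NOT D1, NOT `BetaPertH`, NOT continuum, NOT Clay.  2026-08-28; no existing file touched.
-/

open Finset
open scoped BigOperators Nat
open Literature.MathematicalPhysics.QuantumFieldTheory.LatticeForm (quo)
open Literature.MathematicalPhysics.QuantumFieldTheory.Balaban1983to89
open Literature.MathematicalPhysics.QuantumFieldTheory.Balaban1983to89.Beta
open AffineAveraging AveragingContours AveragingHessianKernels AveragingContoursRooted AveragingHessianKernelsRooted
open B12Sec2to5 (l1 l1_nonneg)
open B4ContourShift (supNorm supNorm_nonneg)
open ExpKernelCalculus (MKer Decays VertexFamily Zl Zl_nonneg Zl_pos summable_exp_shift)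
open OneStepResolventKernel (Fib LocStencil)
open InterLevelTransport (SLam locStencil_SLam)
open KernelWard (divV)
open AveragingWardStencils (b6UnitVec_eq)
open Summit.QuantumFields.BalabanUV.Beta.LinearGaugeVH (nearBox mem_nearBox summable_of_finsupp)
open Summit.QuantumFields.BalabanUV.Beta.SymAveragingHessianCounts (symHessFFAt symHessKerAt symLinKerAt symHessKerAt_eq_zero_left symHessKerAt_eq_zero_right
  abs_symHessKerAt_le biLoc_symHessFFAt)
open Summit.QuantumFields.BalabanUV.Beta.GAN24.HessianGaugeLegContact (exists_finset_near)
open Summit.QuantumFields.BalabanUV.Beta.GAN24.SymHessianGaugeLegContact (SLam_symHessFFAt_inl_inl SLam_symHessFFAt_antisymm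
  tsum_coeff_mul_symHessKerAt_eq_sum SLam_symHessFFAt_inl_inl_eq_zero_of_not_mem tsum_dz_mul_SLam_symHessFFAt)
open Summit.QuantumFields.BalabanUV.Beta.GAN24.Push4 (vertexW vertexW_apply)
open Summit.QuantumFields.BalabanUV.Beta.GAN24.Push4NestAux (decays_vertexW_of_locStencil abs_le_of_decays)
open Summit.QuantumFields.BalabanUV.Beta.GAN24.Push3 (push₃ push₃_inl_inl)
open Summit.QuantumFields.BalabanUV.Beta.GAN24.Push3GaugeSlotCells (tsum_comm_of_window)
open Summit.QuantumFields.BalabanUV.Beta.GAN24.Push3LegTelescope (push₃_sub_left push₃_sub_right push₃_sub_table)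

noncomputable section

namespace Summit.QuantumFields.BalabanUV.Beta.GAN24.SymPush3LambdaGaugeSlotCells

variable {d : ℕ}
variable (l r w : Fin (d + 1) → (Fin (d + 1) → ℤ) → Fin (d + 1) → (Fin (d + 1) → ℤ) → ℝ)
variable (lam : Fin (d + 1) → (Fin (d + 1) → ℤ) → (Fin (d + 1) → ℤ) → ℝ)

/-! ## §1 Locality, window and size of the Λ-piece -/

section Locality

variable {L : ℕ} {rr : Fin (d + 1) → ℕ} {c : Fin (d + 1) → (Fin (d + 1) → ℤ) → Fin (d + 1) → (Fin (d + 1) → ℤ) → ℝ} {Cc δ : ℝ}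

/-- [folklore] **THE Λ-PIECE IS A LOCAL STENCIL FAMILY** (box root; coefficient letter at rate `δ`; an1's `biLoc_symHessFFAt`, lit's `locStencil_SLam`), rate `δ∕2`. -/
theorem locStencil_SLam_symHessFFAt (hL : 1 ≤ L) (hrr : rr ∈ box (d + 1) L) (hc : ∀ μ y κ u, |c μ y κ u| ≤ Cc * Real.exp (-δ * l1 ((L : ℤ) • y - u)))
    (hδ : 0 < δ) (hCc : 0 ≤ Cc) :
    LocStencil (SLam L c (fun μ y => symHessFFAt (toSite rr) L μ y))
      ((d + 1 : ℕ) * (Cc * (2 * (ell (d + 1) L : ℝ) ^ 2 * Real.exp (4 * ((d : ℝ) + 1) * L * δ)) * Zl (d + 1) (δ / 2))) (δ / 2) := by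
  haveI : NeZero L := ⟨by omega⟩
  exact locStencil_SLam (N := L) hc (fun μ y => biLoc_symHessFFAt hL μ y hrr hδ.le) hδ hCc

/-- [folklore] THE WINDOW: both fluctuation sites of a nonzero entry lie in the support box of ONE coarse bond, so `x − z ∈ [−(2L−1), 2L−1]^{d+1}`. -/
theorem SLam_symHessFFAt_eq_zero_of_not_window [NeZero L] (hrr : rr ∈ box (d + 1) L) (κ : Fin (d + 1)) (u : Fin (d + 1) → ℤ) {x z : Fin (d + 1) → ℤ}
    (a b : Fin (d + 1)) (hxz : x - z ∉ Fintype.piFinset fun _ : Fin (d + 1) => Finset.Icc (-(2 * (L : ℤ) - 1)) (2 * (L : ℤ) - 1)) :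
    SLam L c (fun μ y => symHessFFAt (toSite rr) L μ y) κ u x z (Sum.inl a) (Sum.inl b) = 0 := by
  rw [SLam_symHessFFAt_inl_inl, neg_eq_zero]
  refine Finset.sum_eq_zero fun μ _ => ?_
  have hterm : ∀ y, c μ y κ u * symHessKerAt (toSite rr) L μ y (a, x) (b, z) = 0 := by
    intro y
    by_cases hx : Near L y x
    · by_cases hz : Near L y z
      · exfalso
        refine hxz (Fintype.mem_piFinset.2 fun i => Finset.mem_Icc.2 ?_)
        obtain ⟨hx1, hx2⟩ := hx i
        obtain ⟨hz1, hz2⟩ := hz i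
        simp only [Pi.sub_apply]
        constructor <;> linarith
      · rw [symHessKerAt_eq_zero_right hrr _ (f' := (b, z)) hz, mul_zero]
    · rw [symHessKerAt_eq_zero_left hrr (f := (a, x)) hx _, mul_zero]
  simp only [hterm, tsum_zero]

/-- [folklore] SIZE, termwise: for a finite set `s` containing every coarse site near the second fluctuation site,
`|SΛ κ u x z (inl a) (inl b)| ≤ Σ_μ Σ_{y ∈ s} (C_c·2ℓ²)·e^{−δ|L·y − u|₁}` (`abs_symHessKerAt_le`). -/
theorem abs_SLam_symHessFFAt_le_sum [NeZero L] (hL : 1 ≤ L) (hrr : rr ∈ box (d + 1) L) (hc : ∀ μ y κ u, |c μ y κ u| ≤ Cc * Real.exp (-δ * l1 ((L : ℤ) • y - u)))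
    (hCc : 0 ≤ Cc) {s : Finset (Fin (d + 1) → ℤ)} {z : Fin (d + 1) → ℤ} (hs : ∀ y, Near L y z → y ∈ s) (κ : Fin (d + 1)) (u x : Fin (d + 1) → ℤ)
    (a b : Fin (d + 1)) :
    |SLam L c (fun μ y => symHessFFAt (toSite rr) L μ y) κ u x z (Sum.inl a) (Sum.inl b)|
      ≤ ∑ _μ : Fin (d + 1), ∑ y ∈ s, (Cc * (2 * (ell (d + 1) L : ℝ) ^ 2)) * Real.exp (-δ * l1 ((L : ℤ) • y - u)) := by
  rw [SLam_symHessFFAt_inl_inl, abs_neg]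
  simp only [tsum_coeff_mul_symHessKerAt_eq_sum hrr hs]
  refine (Finset.abs_sum_le_sum_abs _ _).trans (Finset.sum_le_sum fun μ _ => ?_)
  refine (Finset.abs_sum_le_sum_abs _ _).trans (Finset.sum_le_sum fun y _ => ?_)
  rw [abs_mul]
  calc |c μ y κ u| * |symHessKerAt (toSite rr) L μ y (a, x) (b, z)|
      ≤ (Cc * Real.exp (-δ * l1 ((L : ℤ) • y - u))) * (2 * (ell (d + 1) L : ℝ) ^ 2) :=
        mul_le_mul (hc μ y κ u) (abs_symHessKerAt_le hL μ y hrr _ _) (abs_nonneg _) (by positivity)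
    _ = _ := by ring

/-- [folklore] **SUMMABILITY IN THE INDEX SITE against any bounded weight** (the coefficient family decays in `u`). -/
theorem summable_mul_SLam_symHessFFAt_idx [NeZero L] (hL : 1 ≤ L) (hrr : rr ∈ box (d + 1) L)
    (hc : ∀ μ y κ u, |c μ y κ u| ≤ Cc * Real.exp (-δ * l1 ((L : ℤ) • y - u))) (hδ : 0 < δ) (hCc : 0 ≤ Cc) {g : (Fin (d + 1) → ℤ) → ℝ} {Cg : ℝ}
    (hg : ∀ u, |g u| ≤ Cg) (κ : Fin (d + 1)) (x z : Fin (d + 1) → ℤ) (a b : Fin (d + 1)) :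
    Summable fun u => g u * SLam L c (fun μ y => symHessFFAt (toSite rr) L μ y) κ u x z (Sum.inl a) (Sum.inl b) := by
  obtain ⟨s, hs⟩ := exists_finset_near hL z
  have hCg : 0 ≤ Cg := (abs_nonneg _).trans (hg 0)
  have hmaj : Summable fun u => Cg * ∑ μ : Fin (d + 1), ∑ y ∈ s, (Cc * (2 * (ell (d + 1) L : ℝ) ^ 2)) * Real.exp (-δ * l1 ((L : ℤ) • y - u)) :=
    (summable_sum fun μ _ => summable_sum fun y _ => (summable_exp_shift hδ ((L : ℤ) • y)).mul_left _).mul_left Cg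
  refine Summable.of_norm_bounded hmaj (fun u => ?_)
  rw [Real.norm_eq_abs, abs_mul]
  exact mul_le_mul (hg u) (abs_SLam_symHessFFAt_le_sum hL hrr hc hCc hs κ u x a b) (abs_nonneg _) hCg

/-- [folklore] The table vertex of the Λ-piece inherits its ANTISYMMETRY (`SLam_symHessFFAt_antisymm` under the index sum). -/
theorem vertexW_lambda_antisymm [NeZero L] (ρ : Fin (d + 1) → ℤ) (κ' : Fin (d + 1)) (u' x z : Fin (d + 1) → ℤ) (a b : Fin (d + 1)) :
    vertexW w (SLam L c (fun μ y => symHessFFAt ρ L μ y)) κ' u' x z (Sum.inl a) (Sum.inl b)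
      = -vertexW w (SLam L c (fun μ y => symHessFFAt ρ L μ y)) κ' u' z x (Sum.inl b) (Sum.inl a) := by
  rw [vertexW_apply, vertexW_apply, ← Finset.sum_neg_distrib]
  refine Finset.sum_congr rfl fun κ _ => ?_
  rw [← tsum_neg]
  refine tsum_congr fun u => ?_
  rw [SLam_symHessFFAt_antisymm ρ L c κ u z x (Sum.inl b) (Sum.inl a)]
  ring

/-- [folklore] The table vertex inherits the WINDOW. -/
theorem vertexW_lambda_eq_zero_of_not_window [NeZero L] (hrr : rr ∈ box (d + 1) L) (κ' : Fin (d + 1)) (u' : Fin (d + 1) → ℤ) {x z : Fin (d + 1) → ℤ}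
    {a b : Fin (d + 1)} (hxz : x - z ∉ Fintype.piFinset fun _ : Fin (d + 1) => Finset.Icc (-(2 * (L : ℤ) - 1)) (2 * (L : ℤ) - 1)) :
    vertexW w (SLam L c (fun μ y => symHessFFAt (toSite rr) L μ y)) κ' u' x z (Sum.inl a) (Sum.inl b) = 0 := by
  rw [vertexW_apply]
  refine Finset.sum_eq_zero fun κ _ => ?_
  simp only [SLam_symHessFFAt_eq_zero_of_not_window hrr κ _ a b hxz, mul_zero, tsum_zero]

/-- [folklore] SIZE of the table vertex for bounded table legs (`locStencil_SLam_symHessFFAt` + leaf-17's `decays_vertexW_of_locStencil`). -/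
theorem exists_vertexW_lambda_bound (hL : 1 ≤ L) (hrr : rr ∈ box (d + 1) L) (hc : ∀ μ y κ u, |c μ y κ u| ≤ Cc * Real.exp (-δ * l1 ((L : ℤ) • y - u)))
    (hδ : 0 < δ) (hCc : 0 ≤ Cc) {Cw : ℝ} (hw : ∀ κ' u' κ u, |w κ' u' κ u| ≤ Cw) (κ' : Fin (d + 1)) (u' : Fin (d + 1) → ℤ) :
    ∃ CV : ℝ, 0 ≤ CV ∧ ∀ x z a b, |vertexW w (SLam L c (fun μ y => symHessFFAt (toSite rr) L μ y)) κ' u' x z a b| ≤ CV := by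
  have hCw : 0 ≤ Cw := (abs_nonneg _).trans (hw 0 0 0 0)
  have hV := decays_vertexW_of_locStencil hw hCw (locStencil_SLam_symHessFFAt hL hrr hc hδ hCc) (by positivity) κ' u'
  exact ⟨_, (abs_nonneg _).trans (abs_le_of_decays hV (by positivity) 0 0 (Sum.inl 0) (Sum.inl 0)),
    fun x z a b => abs_le_of_decays hV (by positivity) x z a b⟩

end Locality

/-! ## §2 THE LEFT SLOT: a pure-gauge first-slot leg reads as the Λ cell (right leg outer, index leg inner) -/

section Left

variable {L : ℕ} {rr : Fin (d + 1) → ℕ} {c : Fin (d + 1) → (Fin (d + 1) → ℤ) → Fin (d + 1) → (Fin (d + 1) → ℤ) → ℝ} {Cc δ Cw : ℝ}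

/-- [folklore] **THE LEFT LEG AGAINST THE Λ VERTEX, INDEX LEG OUTSIDE** (one exchange: the fluctuation site runs over a FINITE window about the right site, the index
site over a SUMMABLE family; then `HessianGaugeLegContact.tsum_dz_mul_SLam_symHessFFAt` under the binders):
`Σ'_x Σ_a (dz ψ)_a x · vertexW w SΛ κ′ u′ x z (inl a) (inl b) = Σ'_u Σ_κ w κ′ u′ κ u · KΛ_sym(ψ; κ,u; b,z)`. -/
theorem inner_gaugeLeft_lambda (hL : 1 ≤ L) (hrr : rr ∈ box (d + 1) L) (hc : ∀ μ y κ u, |c μ y κ u| ≤ Cc * Real.exp (-δ * l1 ((L : ℤ) • y - u)))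
    (hδ : 0 < δ) (hCc : 0 ≤ Cc) (hw : ∀ κ' u' κ u, |w κ' u' κ u| ≤ Cw) (ψ : (Fin (d + 1) → ℤ) → ℝ) (κ' : Fin (d + 1)) (u' z : Fin (d + 1) → ℤ)
    (b : Fin (d + 1)) :
    ∑' x, ∑ a, dz ψ a x * vertexW w (SLam L c (fun μ y => symHessFFAt (toSite rr) L μ y)) κ' u' x z (Sum.inl a) (Sum.inl b)
      = ∑' u, ∑ κ, w κ' u' κ u *
          -(∑ μ, ∑' y, c μ y κ u *
            ((ψ z + ψ (z + unitVec b) - ψ ((L : ℤ) • y + toSite rr) - ψ ((L : ℤ) • y + toSite rr + (L : ℤ) • unitVec μ))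
              * symLinKerAt (toSite rr) L μ y (b, z) / 2)) := by
  classical
  haveI : NeZero L := ⟨by omega⟩
  set S := SLam L c (fun μ y => symHessFFAt (toSite rr) L μ y) with hSdef
  obtain ⟨s, hs⟩ := exists_finset_near hL z
  set X : Finset (Fin (d + 1) → ℤ) := s.biUnion fun y => nearBox L y with hX
  -- the `x`-window and the `u`-summability
  have hxzero : ∀ x ∉ X, ∀ κ u a, S κ u x z (Sum.inl a) (Sum.inl b) = 0 :=
    fun x hx κ u a => SLam_symHessFFAt_inl_inl_eq_zero_of_not_mem hrr hs c κ u a b hx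
  have hsu : ∀ x a κ, Summable fun u => dz ψ a x * (w κ' u' κ u * S κ u x z (Sum.inl a) (Sum.inl b)) := by
    intro x a κ
    have h := (summable_mul_SLam_symHessFFAt_idx hL hrr hc hδ hCc (g := fun u => w κ' u' κ u) (hw κ' u' κ) κ x z a b).mul_left (dz ψ a x)
    exact h.congr fun u => by rw [hSdef]
  -- the left-hand side as `Σ_{x ∈ X} Σ'_u Φ x u`
  have hLHS : ∀ x, (∑ a, dz ψ a x * vertexW w S κ' u' x z (Sum.inl a) (Sum.inl b))
      = ∑' u, ∑ a, ∑ κ, dz ψ a x * (w κ' u' κ u * S κ u x z (Sum.inl a) (Sum.inl b)) := by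
    intro x
    calc (∑ a, dz ψ a x * vertexW w S κ' u' x z (Sum.inl a) (Sum.inl b))
        = ∑ a, ∑ κ, ∑' u, dz ψ a x * (w κ' u' κ u * S κ u x z (Sum.inl a) (Sum.inl b)) := by
          refine Finset.sum_congr rfl fun a _ => ?_
          rw [vertexW_apply, Finset.mul_sum]
          refine Finset.sum_congr rfl fun κ _ => ?_
          rw [← tsum_mul_left]
      _ = ∑ a, ∑' u, ∑ κ, dz ψ a x * (w κ' u' κ u * S κ u x z (Sum.inl a) (Sum.inl b)) := by
          refine Finset.sum_congr rfl fun a _ => ?_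
          rw [Summable.tsum_finsetSum fun κ _ => hsu x a κ]
      _ = _ := by rw [Summable.tsum_finsetSum fun a _ => summable_sum fun κ _ => hsu x a κ]
  have hLHS0 : ∀ x ∉ X, (∑' u, ∑ a, ∑ κ, dz ψ a x * (w κ' u' κ u * S κ u x z (Sum.inl a) (Sum.inl b))) = 0 := by
    intro x hx
    have : ∀ u, (∑ a, ∑ κ, dz ψ a x * (w κ' u' κ u * S κ u x z (Sum.inl a) (Sum.inl b))) = 0 := fun u =>
      Finset.sum_eq_zero fun a _ => Finset.sum_eq_zero fun κ _ => by rw [hxzero x hx κ u a, mul_zero, mul_zero]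
    simp only [this, tsum_zero]
  rw [tsum_congr hLHS, tsum_eq_sum (s := X) hLHS0,
    ← Summable.tsum_finsetSum (fun x _ => summable_sum fun a _ => summable_sum fun κ _ => hsu x a κ)]
  refine tsum_congr fun u => ?_
  -- back to the full `x`-sum inside, then the Λ law
  have hRHS : (∑ κ, w κ' u' κ u * ∑' x, ∑ a, dz ψ a x * S κ u x z (Sum.inl a) (Sum.inl b))
      = ∑ x ∈ X, ∑ a, ∑ κ, dz ψ a x * (w κ' u' κ u * S κ u x z (Sum.inl a) (Sum.inl b)) := by
    have hin : ∀ κ, ∑' x, ∑ a, dz ψ a x * S κ u x z (Sum.inl a) (Sum.inl b) = ∑ x ∈ X, ∑ a, dz ψ a x * S κ u x z (Sum.inl a) (Sum.inl b) :=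
      fun κ => tsum_eq_sum fun x hx => Finset.sum_eq_zero fun a _ => by rw [hxzero x hx κ u a, mul_zero]
    simp only [hin, Finset.mul_sum]
    rw [Finset.sum_comm]
    refine Finset.sum_congr rfl fun x _ => ?_
    rw [Finset.sum_comm]
    refine Finset.sum_congr rfl fun a _ => Finset.sum_congr rfl fun κ _ => ?_
    ring
  rw [← hRHS]
  refine Finset.sum_congr rfl fun κ _ => ?_
  rw [hSdef, tsum_dz_mul_SLam_symHessFFAt hL hrr c κ u z b ψ]

/-- [folklore] **THE LEFT SLOT**: with a pure-gauge LEFT leg family, every field entry of the push of the Λ-piece is the Λ one-gauge cell sum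
(`ContactOneGaugeCellLambda.cellLambda_eq`'s nesting: right leg OUTER, index leg INSIDE):
`push₃ (dz λ) r w SΛ κ′ u′ x′ z′ (inl α) (inl β) = Σ'_z Σ_b r β z′ b z · Σ'_u Σ_κ w κ′ u′ κ u · KΛ_sym(λ_{αx′}; κ,u; b,z)`. -/
theorem push₃_gaugeLeft_lambda (hL : 1 ≤ L) (hrr : rr ∈ box (d + 1) L) (hc : ∀ μ y κ u, |c μ y κ u| ≤ Cc * Real.exp (-δ * l1 ((L : ℤ) • y - u)))
    (hδ : 0 < δ) (hCc : 0 ≤ Cc) (hw : ∀ κ' u' κ u, |w κ' u' κ u| ≤ Cw) (κ' : Fin (d + 1)) (u' x' z' : Fin (d + 1) → ℤ) (α β : Fin (d + 1)) :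
    push₃ (fun μ y κ u => dz (lam μ y) κ u) r w (SLam L c (fun μ y => symHessFFAt (toSite rr) L μ y)) κ' u' x' z' (Sum.inl α) (Sum.inl β)
      = ∑' z, ∑ b, r β z' b z * ∑' u, ∑ κ, w κ' u' κ u *
          -(∑ μ, ∑' y, c μ y κ u *
            ((lam α x' z + lam α x' (z + unitVec b) - lam α x' ((L : ℤ) • y + toSite rr) - lam α x' ((L : ℤ) • y + toSite rr + (L : ℤ) • unitVec μ))
              * symLinKerAt (toSite rr) L μ y (b, z) / 2)) := by
  rw [push₃_inl_inl]
  refine tsum_congr fun z => Finset.sum_congr rfl fun b _ => ?_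
  rw [mul_comm, inner_gaugeLeft_lambda w hL hrr hc hδ hCc hw (lam α x') κ' u' z b]

end Left

end Summit.QuantumFields.BalabanUV.Beta.GAN24.SymPush3LambdaGaugeSlotCells

end
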